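import Literature.Probability.RandomPlanarGeometry.ConformalRemovabilityWhitneyTree
import Literature.Analysis.Complex.DiscSubMeanValue
import Mathlib.Analysis.Real.Pi.Bounds
import HarnessLib

/-!
# Conformal removability: chains of Whitney discs along rays, and hubs

Support for the proof of `JonesSmirnov2000_frontier_of_isHolderDomain` (P. W. Jones,
S. K. Smirnov, Ark. Mat. 38 (2000) 263–279, Cor. 2), geometric half of Prop. 1 (pp. 270–272):

* "for any two adjacent Whitney cubes `Q` and `Q'` … `|f(Q) - f(Q')| ≤ 2^{n-1}(|∇f|(Q) l(Q) +
  |∇f|(Q') l(Q'))`" — here for discs and point values: `enorm_sub_parent_le`,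
  `‖F(parent v) - F(v)‖ ≤ 4 (∫_{B(v, 11 r(v))} |F'|²)^{1/2} =: c(v)` (from the sub-mean-value
  estimate `pi_mul_sq_mul_enorm_sub_sq_le`);
* "one can choose a bi-infinite sequence of cubes, such that its tails converge to `uᵢ` and
  `uᵢ₊₁` … applying the inequality above to this sequence one obtains `|f(uᵢ) - f(uᵢ₊₁)| ≤
  2ⁿ Σ |∇f|(Q) l(Q)`" — `enorm_sub_le_tsum_indicator_of_ray`: along a ray `X` from `h` landing at
  `z`, `‖F(h) - F(z)‖ ≤ Σ_{v ∈ T} c(v)` for any set `T` containing the ray (each disc counted once,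
  `sum_ray_le_tsum_indicator`);
* the hubs (the cubes "of the size `Δ`" through which the curves to `uᵢ`, `uᵢ₊₁` pass, p. 270):
  given a finite set `H₀` of vertices containing the root, every ray from the root splits at its
  last visit to `H₀`; the next vertex is its *hub* (`exists_hub_of_ray`), the remaining ray avoids
  `H₀`, its vertices lie in the `H₀`-free subtree `{w | ∃ m, parent^[m] w = h, parent^[i] w ∉ H₀
  (i ≤ m)}` of the hub (`ray_mem_subtree`), and these subtrees are pairwise disjoint over the
  hubs (`subtree_disjoint`), so that no disc is counted twice ("we can assume that no Whitney cube
  is entered by two different curves", p. 272);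
* `abs_im_sub_le_of_ray`: the vertices of a ray landing on the line `Im z = y` satisfy
  `|Im v - y| ≤ 6 τ(v)` (`WhitneyTree.dist_ray_le` and the tail majorant).
-/

noncomputable section

open Set Metric MeasureTheory Filter

open scoped NNReal ENNReal Topology

namespace Literature.Probability.RandomPlanarGeometry

open Literature.Analysis.Complex (pi_mul_sq_mul_enorm_sub_sq_le)

variable {Ω : Set ℂ}

namespace WhitneyTree

variable (W : WhitneyTree Ω)

/-! ### The edge estimate -/

/-- **Oscillation between adjacent Whitney discs** (Jones–Smirnov 2000, p. 271, disc version with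
point values): if `F` is holomorphic on `B(v, 11 r(v))`, then
`‖F(parent v) - F(v)‖ₑ ≤ 4 (∫_{B(v, 11 r(v))} ‖F'‖ₑ²)^{1/2}` (the parent centre lies in
`B(v, 6.2 r(v))`; sub-mean-value estimate `pi_mul_sq_mul_enorm_sub_sq_le`). [cite: JonesSmirnov2000, proof of Prop. 1 (p. 271)] -/
theorem enorm_sub_parent_le {F : ℂ → ℂ} {v : W.S} (hv : v ≠ W.root)
    (hr : 0 < infDist (v : ℂ) Ωᶜ)
    (hF : DifferentiableOn ℂ F (ball (v : ℂ) (11 * (infDist (v : ℂ) Ωᶜ / 100)))) :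
    ‖F (W.parent v) - F v‖ₑ ≤
      4 * (∫⁻ w in ball (v : ℂ) (11 * (infDist (v : ℂ) Ωᶜ / 100)), ‖deriv F w‖ₑ ^ 2) ^
        (1 / 2 : ℝ) := by
  set r : ℝ := infDist (v : ℂ) Ωᶜ / 100 with hrdef
  set J : ℝ≥0∞ := ∫⁻ w in ball (v : ℂ) (11 * r), ‖deriv F w‖ₑ ^ 2 with hJ
  have hr0 : 0 < r := by positivity
  have hd : dist (W.parent v : ℂ) v < 31 / 5 * r := by
    have h1 := dist_lt_of_triple_balls (W.adj_parent v hv).2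
    have h2 := W.infDist_parent_le hv
    rw [dist_comm] at h1
    simp only [hrdef]
    linarith
  have hyR : dist (W.parent v : ℂ) v + r ≤ 11 * r := by linarith
  have key := pi_mul_sq_mul_enorm_sub_sq_le (F := F) hr0 hyR hF
  have h1 : ENNReal.ofReal (dist (W.parent v : ℂ) v ^ 2) ≤
      ENNReal.ofReal (16 * (Real.pi * r ^ 2)) := by
    refine ENNReal.ofReal_le_ofReal ?_
    have hd0 : 0 ≤ dist (W.parent v : ℂ) v := dist_nonneg
    nlinarith [Real.pi_gt_three]
  have h2 : ENNReal.ofReal (Real.pi * r ^ 2) * ‖F (W.parent v) - F v‖ₑ ^ 2 ≤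
      ENNReal.ofReal (Real.pi * r ^ 2) * (16 * J) := by
    calc ENNReal.ofReal (Real.pi * r ^ 2) * ‖F (W.parent v) - F v‖ₑ ^ 2
        ≤ ENNReal.ofReal (dist (W.parent v : ℂ) v ^ 2) * J := key
      _ ≤ ENNReal.ofReal (16 * (Real.pi * r ^ 2)) * J := by gcongr
      _ = ENNReal.ofReal (Real.pi * r ^ 2) * (16 * J) := by
          rw [ENNReal.ofReal_mul (by norm_num), ENNReal.ofReal_ofNat]
          ring
  have hπ0 : ENNReal.ofReal (Real.pi * r ^ 2) ≠ 0 := (ENNReal.ofReal_pos.2 (by positivity)).ne'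
  have h3 : ‖F (W.parent v) - F v‖ₑ ^ 2 ≤ 16 * J :=
    (ENNReal.mul_le_mul_iff_right hπ0 ENNReal.ofReal_ne_top).1 h2
  have h16 : (16 : ℝ≥0∞) ^ (1 / 2 : ℝ) = 4 := by
    rw [show (16 : ℝ≥0∞) = 4 ^ (2 : ℕ) by norm_num, ← ENNReal.rpow_natCast, ← ENNReal.rpow_mul]
    norm_num
  calc ‖F (W.parent v) - F v‖ₑ = (‖F (W.parent v) - F v‖ₑ ^ (2 : ℕ)) ^ (1 / 2 : ℝ) := by
        rw [← ENNReal.rpow_natCast, ← ENNReal.rpow_mul]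
        norm_num
    _ ≤ (16 * J) ^ (1 / 2 : ℝ) := ENNReal.rpow_le_rpow h3 (by norm_num)
    _ = 4 * J ^ (1 / 2 : ℝ) := by rw [ENNReal.mul_rpow_of_nonneg _ _ (by norm_num), h16]

/-! ### Chains along rays -/

/-- Telescoping: `‖f 0 - f N‖ₑ ≤ Σ_{n < N} ‖f n - f (n+1)‖ₑ`. [folklore] -/
theorem enorm_sub_le_sum_range {E : Type*} [NormedAddCommGroup E] (f : ℕ → E) (N : ℕ) :
    ‖f 0 - f N‖ₑ ≤ ∑ n ∈ Finset.range N, ‖f n - f (n + 1)‖ₑ := by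
  induction N with
  | zero => simp
  | succ N ih =>
    rw [Finset.sum_range_succ]
    calc ‖f 0 - f (N + 1)‖ₑ ≤ ‖f 0 - f N‖ₑ + ‖f N - f (N + 1)‖ₑ := by
          have := edist_triangle (f 0) (f N) (f (N + 1))
          simpa only [edist_eq_enorm_sub] using this
      _ ≤ _ := add_le_add ih le_rfl

/-- Iterating the parent map along a ray goes back: `parent^[k] (x (n + k)) = x n`. [folklore] -/
theorem iterate_parent_ray {x : ℕ → W.S} (hx : ∀ n, W.parent (x (n + 1)) = x n) (n k : ℕ) :
    W.parent^[k] (x (n + k)) = x n := by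
  induction k with
  | zero => simp
  | succ k ih =>
    rw [Function.iterate_succ_apply, show n + (k + 1) = n + k + 1 by ring, hx, ih]

/-- A ray of the Whitney tree is injective (levels strictly increase). [folklore] -/
theorem injective_ray' {x : ℕ → W.S} (hx : ∀ n, W.parent (x (n + 1)) = x n)
    (hx0 : ∀ n, x (n + 1) ≠ W.root) : Function.Injective x :=
  injective_ray (q := fun v : W.S => W.q v) W.q_parent hx hx0

/-- **Each disc counted once**: along a ray `x`, `Σ_{n < N} c(x (n+1)) ≤ Σ_{v ∈ T} c(v)` for any
set `T` containing the `x (n+1)`. [folklore] -/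
theorem sum_ray_le_tsum_indicator {x : ℕ → W.S} (hx : ∀ n, W.parent (x (n + 1)) = x n)
    (hx0 : ∀ n, x (n + 1) ≠ W.root) (c : W.S → ℝ≥0∞) {T : Set W.S} (hT : ∀ n, x (n + 1) ∈ T)
    (N : ℕ) : ∑ n ∈ Finset.range N, c (x (n + 1)) ≤ ∑' v, T.indicator c v := by
  classical
  have hinj : Set.InjOn (fun n => x (n + 1)) ↑(Finset.range N) := fun a _ b _ h =>
    Nat.succ_injective (W.injective_ray' hx hx0 h)
  calc ∑ n ∈ Finset.range N, c (x (n + 1))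
      = ∑ v ∈ (Finset.range N).image (fun n => x (n + 1)), c v := (Finset.sum_image hinj).symm
    _ = ∑ v ∈ (Finset.range N).image (fun n => x (n + 1)), T.indicator c v := by
        refine Finset.sum_congr rfl fun v hv => ?_
        obtain ⟨n, -, rfl⟩ := Finset.mem_image.1 hv
        rw [Set.indicator_of_mem (hT n)]
    _ ≤ ∑' v, T.indicator c v := ENNReal.sum_le_tsum _

/-- **The chain estimate along a ray** (Jones–Smirnov 2000, p. 271): if `x` is a ray from `h`
converging to `z`, `F (x n) → F z`, every step satisfies `‖F(x n) - F(x (n+1))‖ₑ ≤ c (x (n+1))`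
and the `x (n+1)` lie in `T`, then `‖F(h) - F(z)‖ₑ ≤ Σ_{v ∈ T} c(v)`. [cite: JonesSmirnov2000, proof of Prop. 1 (p. 271)] -/
theorem enorm_sub_le_tsum_indicator_of_ray {F : ℂ → ℂ} {x : ℕ → W.S}
    (hx : ∀ n, W.parent (x (n + 1)) = x n) (hx0 : ∀ n, x (n + 1) ≠ W.root) {c : W.S → ℝ≥0∞}
    (hedge : ∀ n, ‖F (x n) - F (x (n + 1))‖ₑ ≤ c (x (n + 1))) {T : Set W.S}
    (hT : ∀ n, x (n + 1) ∈ T) {z : ℂ} (hFz : Tendsto (fun n => F (x n)) atTop (𝓝 (F z))) :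
    ‖F (x 0) - F z‖ₑ ≤ ∑' v, T.indicator c v := by
  have hN : ∀ N, ‖F (x 0) - F (x N)‖ₑ ≤ ∑' v, T.indicator c v := fun N =>
    calc ‖F (x 0) - F (x N)‖ₑ ≤ ∑ n ∈ Finset.range N, ‖F (x n) - F (x (n + 1))‖ₑ :=
          enorm_sub_le_sum_range (fun n => F (x n)) N
      _ ≤ ∑ n ∈ Finset.range N, c (x (n + 1)) := Finset.sum_le_sum fun n _ => hedge n
      _ ≤ ∑' v, T.indicator c v := W.sum_ray_le_tsum_indicator hx hx0 c hT N
  have hlim : Tendsto (fun N => ‖F (x 0) - F (x N)‖ₑ) atTop (𝓝 ‖F (x 0) - F z‖ₑ) :=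
    (tendsto_const_nhds.sub hFz).enorm
  exact le_of_tendsto' hlim hN

/-- **Vertices of a ray landing on a horizontal line are close to it**: if the radii along rays
from `x k` on sum to `≤ τ (x k)` and the ray converges to `z`, then
`|Im (x k) - Im z| ≤ dist(x k, z) ≤ 6 τ (x k)`. [cite: JonesSmirnov2000, §3 proof of Thm. 2 (p. 274)] -/
theorem abs_im_sub_le_of_ray (φ : ConformalEquiv (ball (0 : ℂ) 1) Ω) {C α : ℝ≥0} (hα : 0 < α)
    (hH : HolderOnWith C α φ (ball (0 : ℂ) 1)) {τ : W.S → ℝ}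
    (hτ : ∀ x : ℕ → W.S, (∀ n, W.parent (x (n + 1)) = x n) → (∀ n, x (n + 1) ≠ W.root) →
      ∀ k, ∑' n, infDist (x (k + n) : ℂ) Ωᶜ / 100 ≤ τ (x k))
    {x : ℕ → W.S} (hx : ∀ n, W.parent (x (n + 1)) = x n) (hx0 : ∀ n, x (n + 1) ≠ W.root)
    {z : ℂ} (hz : Tendsto (fun n => (x n : ℂ)) atTop (𝓝 z)) (k : ℕ) :
    |(x k : ℂ).im - z.im| ≤ 6 * τ (x k) := by
  have h1 := W.dist_ray_le φ hα hH hx hx0 hz k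
  have h2 := hτ x hx hx0 k
  calc |(x k : ℂ).im - z.im| = |((x k : ℂ) - z).im| := by rw [Complex.sub_im]
    _ ≤ ‖(x k : ℂ) - z‖ := Complex.abs_im_le_norm _
    _ = dist (x k : ℂ) z := (dist_eq_norm _ _).symm
    _ ≤ 6 * τ (x k) := by linarith

/-! ### Hubs -/

/-- **The hub of a ray.** Given a finite set `H₀` of vertices containing the root, a ray from the
root converging to `z` leaves `H₀` for the last time at some vertex; the next vertex `h ∉ H₀`
(with `parent h ∈ H₀`) starts a ray avoiding `H₀` and converging to `z`. [cite: JonesSmirnov2000, proof of Prop. 1 (p. 270)] -/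
theorem exists_hub_of_ray {H₀ : Finset W.S} (hroot : W.root ∈ H₀) {x : ℕ → W.S}
    (hx0r : x 0 = W.root) (hx : ∀ n, W.parent (x (n + 1)) = x n)
    (hx0 : ∀ n, x (n + 1) ≠ W.root) {z : ℂ} (hz : Tendsto (fun n => (x n : ℂ)) atTop (𝓝 z)) :
    ∃ (h : W.S) (y : ℕ → W.S), h ∉ H₀ ∧ W.parent h ∈ H₀ ∧ y 0 = h ∧
      (∀ n, W.parent (y (n + 1)) = y n) ∧ (∀ n, y (n + 1) ≠ W.root) ∧ (∀ n, y n ∉ H₀) ∧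
      Tendsto (fun n => (y n : ℂ)) atTop (𝓝 z) := by
  classical
  have hinj := W.injective_ray' hx hx0
  have hfin : {n : ℕ | x n ∈ H₀}.Finite :=
    (H₀.finite_toSet.preimage hinj.injOn)
  have hne : hfin.toFinset.Nonempty := ⟨0, hfin.mem_toFinset.2 (by simpa [hx0r] using hroot)⟩
  set n₀ := hfin.toFinset.max' hne with hn₀
  have hn₀mem : x n₀ ∈ H₀ := by
    have := hfin.toFinset.max'_mem hne
    rw [hfin.mem_toFinset] at this
    exact this
  have hafter : ∀ n, n₀ < n → x n ∉ H₀ := fun n hn hmem =>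
    absurd (hfin.toFinset.le_max' n (hfin.mem_toFinset.2 hmem)) (not_le.2 hn)
  refine ⟨x (n₀ + 1), fun n => x (n₀ + 1 + n), hafter _ (Nat.lt_succ_self _), ?_, by simp, ?_,
    ?_, ?_, ?_⟩
  · rw [hx]; exact hn₀mem
  · intro n
    show W.parent (x (n₀ + 1 + (n + 1))) = x (n₀ + 1 + n)
    rw [show n₀ + 1 + (n + 1) = n₀ + 1 + n + 1 by ring, hx]
  · intro n
    show x (n₀ + 1 + (n + 1)) ≠ W.root
    rw [show n₀ + 1 + (n + 1) = n₀ + 1 + n + 1 by ring]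
    exact hx0 _
  · intro n
    exact hafter _ (by omega)
  · have := (tendsto_add_atTop_iff_nat (n₀ + 1)).2 hz
    simpa only [add_comm] using this

/-- The vertices of a ray from `h` avoiding `H₀` lie in the `H₀`-free subtree of `h`. [folklore] -/
theorem ray_mem_subtree {H₀ : Finset W.S} {y : ℕ → W.S} {h : W.S} (hy0 : y 0 = h)
    (hy : ∀ n, W.parent (y (n + 1)) = y n) (hyH : ∀ n, y n ∉ H₀) (n : ℕ) :
    y n ∈ {w : W.S | ∃ m, W.parent^[m] w = h ∧ ∀ i ≤ m, W.parent^[i] w ∉ H₀} := by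
  refine ⟨n, ?_, fun i hi => ?_⟩
  · have := W.iterate_parent_ray hy 0 n
    rwa [zero_add, hy0] at this
  · have := W.iterate_parent_ray hy (n - i) i
    rw [show n - i + i = n by omega] at this
    rw [this]
    exact hyH _

/-- **The `H₀`-free subtrees of distinct hubs are disjoint**: if `h ∉ H₀`, `h' ∉ H₀` have parents in
`H₀` and a vertex `w` reaches both by `H₀`-avoiding parent chains, then `h = h'`. [folklore] -/
theorem subtree_disjoint {H₀ : Finset W.S} {h h' w : W.S} (hh : W.parent h ∈ H₀)
    (hh' : W.parent h' ∈ H₀) {m m' : ℕ} (hm : W.parent^[m] w = h)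
    (hmH : ∀ i ≤ m, W.parent^[i] w ∉ H₀) (hm' : W.parent^[m'] w = h')
    (hm'H : ∀ i ≤ m', W.parent^[i] w ∉ H₀) : h = h' := by
  rcases lt_trichotomy m m' with hlt | heq | hgt
  · exfalso
    refine hm'H (m + 1) hlt ?_
    rw [Function.iterate_succ_apply', hm]
    exact hh
  · subst heq
    rw [← hm, ← hm']
  · exfalso
    refine hmH (m' + 1) hgt ?_
    rw [Function.iterate_succ_apply', hm']
    exact hh'

end WhitneyTree

end Literature.Probability.RandomPlanarGeometry
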